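import Mathlib
import HarnessLib
import Summits.HubbardSuperconductivity.HubbardSuperconductivity.Theorems.DeformationLadderLowEnergyRigidityCondensateHeavy

/-!
# Route `DeformationLadder` — crux `LowEnergyRigidity` (stmt-HubbardSuperconductivity-1892),
# crux idea `heavy-condensate-fibration`, item 3: BLOCK condensates are heavy with mass `∝ |B|`

For an arbitrary finite set `B` of torus sites, the block pair field `Δ_B = Σ_{x ∈ B} P_x`
(`P_x = localPair g L x`), the block amplitude `u_B = |B|⁻¹ Δ_B` and the block condensate
`Π_B = u_Bᴴ u_B = |B|⁻² Δ_Bᴴ Δ_B`: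
`‖[Π_B, [Π_B, H]]‖ ≤ (9000 + 144 s²(s+2)) K⁴ (2|t|+|U|+2|μ|) / |B|`
(`hcf_norm_blockCondensate_doubleCommutator_le`), uniformly in the volume and in the shape of `B`
— the card's "every block pair field `u_B = ℓ⁻² Δ_B` is heavy with mass `∝ ℓ²`", which is what lets
`H_L` fibre jointly over the block amplitudes (item 3), and the block input of the companion card
`poincare-telescope` (cells `cellPair`, blocks `blockPair` are such sums). The proof is the one of
`…CondensateHeavy` (`B = univ`) with the three graded-locality inputs re-counted inside `B`:
`‖Δ_B‖ ≤ K|B|`, `‖[H, Δ_B]‖ ≤ 90 J K |B|`, `‖[Δ_B, Δ_Bᴴ]‖ ≤ 50 K² |B|`,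
`‖[Δ_B,[Δ_B,H]]‖, ‖[Δ_Bᴴ,[Δ_B,H]]‖ ≤ 36 s²(s+2) K² J |B|` (`dcq_norm_doubleCommutator_le` over the
index type `B`). Koma–Tasaki 1994, proof of Thm 2.2 (locality count).
-/

namespace Summit.HubbardSuperconductivity.HubbardSuperconductivity.Theorems

set_option linter.dupNamespace false

open Literature.MathematicalPhysics.QuantumLattice Literature.Probability.LatticeModels Matrix
open scoped Matrix.Norms.L2Operator ComplexOrder

section Block

variable (g : Site 2 → ℝ) (L : ℕ) [NeZero L] (B : Finset (TorusSite 2 L))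

/-- `‖Δ_B‖ ≤ K |B|`, `K = 2 Σ_e |g e/√2|`. [folklore] -/
theorem hcf_norm_blockPairField_le [inst : DecidableEq (FermionTorus 2 L)] :
    ‖∑ x ∈ B, localPair g L x‖ ≤ (2 * ∑ e ∈ insert (0 : Site 2) unitSteps, |g e / Real.sqrt 2|) * B.card := by
  refine (norm_sum_le _ _).trans ?_
  calc ∑ x ∈ B, ‖localPair g L x‖ ≤ ∑ _x ∈ B, 2 * ∑ e ∈ insert (0 : Site 2) unitSteps, |g e / Real.sqrt 2| :=
        Finset.sum_le_sum fun x _ => norm_localPair_le g L x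
    _ = _ := by rw [Finset.sum_const, nsmul_eq_mul]; ring

/-- `‖[H, Δ_B]‖ ≤ 45 · 2(2|t|+|U|+2|μ|) · K · |B|`. [folklore] -/
theorem hcf_norm_comm_hubbardTorusWith_blockPairField_le (t U μ : ℝ) [inst : DecidableEq (FermionTorus 2 L)] :
    ‖hubbardTorusWith 2 L t U μ * (∑ x ∈ B, localPair g L x) -
        (∑ x ∈ B, localPair g L x) * hubbardTorusWith 2 L t U μ‖ ≤
      45 * (2 * (2 * |t| + |U| + 2 * |μ|) * (2 * ∑ e ∈ insert (0 : Site 2) unitSteps, |g e / Real.sqrt 2|)) *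
        B.card := by
  have hinst : inst = LinearOrder.toDecidableEq := Subsingleton.elim _ _
  subst hinst
  rw [Finset.mul_sum, Finset.sum_mul, ← Finset.sum_sub_distrib]
  refine (norm_sum_le _ _).trans ?_
  calc ∑ x ∈ B, ‖hubbardTorusWith 2 L t U μ * localPair g L x - localPair g L x * hubbardTorusWith 2 L t U μ‖
      ≤ ∑ _x ∈ B, 45 * (2 * (2 * |t| + |U| + 2 * |μ|) *
          (2 * ∑ e ∈ insert (0 : Site 2) unitSteps, |g e / Real.sqrt 2|)) :=
        Finset.sum_le_sum fun x _ => twAhm_norm_comm_hubbardTorusWith_localPair_le L t U μ g x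
    _ = _ := by rw [Finset.sum_const, nsmul_eq_mul]; ring

/-- **`‖[Δ_B, Δ_Bᴴ]‖ ≤ 25 · 2K² · |B|`**: for each `x ∈ B` at most `25` adjoint local pairs fail to
commute with `P_x`. Bratteli–Robinson II §5.2.2. [folklore] -/
theorem hcf_norm_comm_blockPairField_conjTranspose_le [inst : DecidableEq (FermionTorus 2 L)] :
    ‖(∑ x ∈ B, localPair g L x) * (∑ x ∈ B, localPair g L x)ᴴ -
        (∑ x ∈ B, localPair g L x)ᴴ * (∑ x ∈ B, localPair g L x)‖ ≤
      25 * (2 * (2 * ∑ e ∈ insert (0 : Site 2) unitSteps, |g e / Real.sqrt 2|) ^ 2) * B.card := by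
  -- adapted from `twAhm_norm_comm_pairField_conjTranspose_le` (the case `B = univ`)
  have hinst : inst = LinearOrder.toDecidableEq := Subsingleton.elim _ _
  subst hinst
  set p : ℝ := 2 * ∑ e ∈ insert (0 : Site 2) unitSteps, |g e / Real.sqrt 2| with hp
  have hp0 : 0 ≤ p := by positivity
  have hP : ∀ x : TorusSite 2 L, ‖localPair g L x‖ ≤ p := fun x => norm_localPair_le g L x
  set T : TorusSite 2 L → TorusSite 2 L →
      Matrix (Finset (Orb (FermionTorus 2 L))) (Finset (Orb (FermionTorus 2 L))) ℂ :=
    fun x y => localPair g L x * (localPair g L y)ᴴ - (localPair g L y)ᴴ * localPair g L x with hT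
  have hsum : (∑ x ∈ B, localPair g L x) * (∑ x ∈ B, localPair g L x)ᴴ -
      (∑ x ∈ B, localPair g L x)ᴴ * (∑ x ∈ B, localPair g L x) = ∑ x ∈ B, ∑ y ∈ B, T x y := by
    rw [conjTranspose_sum, Finset.sum_mul, Finset.mul_sum, ← Finset.sum_sub_distrib]
    refine Finset.sum_congr rfl fun x _ => ?_
    rw [Finset.mul_sum, Finset.sum_mul, ← Finset.sum_sub_distrib]
  have hterm : ∀ x y : TorusSite 2 L, ‖T x y‖ ≤ 2 * p ^ 2 := by
    intro x y
    have h1 : ‖(localPair g L y)ᴴ‖ ≤ p := by rw [l2_opNorm_conjTranspose]; exact hP y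
    calc ‖T x y‖ ≤ ‖localPair g L x * (localPair g L y)ᴴ‖ + ‖(localPair g L y)ᴴ * localPair g L x‖ :=
          norm_sub_le _ _
      _ ≤ ‖localPair g L x‖ * ‖(localPair g L y)ᴴ‖ + ‖(localPair g L y)ᴴ‖ * ‖localPair g L x‖ :=
          add_le_add (norm_mul_le _ _) (norm_mul_le _ _)
      _ ≤ p * p + p * p := add_le_add (mul_le_mul (hP x) h1 (norm_nonneg _) hp0)
          (mul_le_mul h1 (hP x) (norm_nonneg _) hp0)
      _ = 2 * p ^ 2 := by ring
  have hx : ∀ x : TorusSite 2 L, ∑ y ∈ B, ‖T x y‖ ≤ 25 * (2 * p ^ 2) := by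
    intro x
    have hle : ∀ y : TorusSite 2 L, ‖T x y‖ ≤
        if Disjoint ((insert (0 : Site 2) unitSteps).image
            fun e => FermionTorus.ofTorusSite (x + Torus.proj L e))
          ((insert (0 : Site 2) unitSteps).image
            fun e => FermionTorus.ofTorusSite (y + Torus.proj L e)) then 0 else 2 * p ^ 2 := by
      intro y
      split_ifs with h
      · rw [show T x y = 0 from twAhm_comm_localPair_eq_zero L g h, norm_zero]
      · exact hterm x y
    calc ∑ y ∈ B, ‖T x y‖
        ≤ ∑ y ∈ B, (if Disjoint ((insert (0 : Site 2) unitSteps).image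
              fun e => FermionTorus.ofTorusSite (x + Torus.proj L e))
            ((insert (0 : Site 2) unitSteps).image
              fun e => FermionTorus.ofTorusSite (y + Torus.proj L e)) then 0 else 2 * p ^ 2) :=
          Finset.sum_le_sum fun y _ => hle y
      _ = 2 * p ^ 2 * ((B.filter fun y : TorusSite 2 L =>
            ¬ Disjoint ((insert (0 : Site 2) unitSteps).image
                fun e => FermionTorus.ofTorusSite (x + Torus.proj L e))
              ((insert (0 : Site 2) unitSteps).image
                fun e => FermionTorus.ofTorusSite (y + Torus.proj L e))).card) := by
          rw [Finset.sum_ite, Finset.sum_const_zero, zero_add, Finset.sum_const, nsmul_eq_mul,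
            mul_comm]
      _ ≤ 2 * p ^ 2 * 25 := by
          gcongr
          have hsub : (B.filter fun y : TorusSite 2 L =>
              ¬ Disjoint ((insert (0 : Site 2) unitSteps).image
                  fun e => FermionTorus.ofTorusSite (x + Torus.proj L e))
                ((insert (0 : Site 2) unitSteps).image
                  fun e => FermionTorus.ofTorusSite (y + Torus.proj L e))) ⊆
              ((insert (0 : Site 2) unitSteps) ×ˢ (insert (0 : Site 2) unitSteps)).image
                fun p => x + Torus.proj L p.1 - Torus.proj L p.2 :=
            fun y hy => twAhm_mem_candidates L (Finset.mem_filter.1 hy).2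
          exact_mod_cast (Finset.card_le_card hsub).trans (twAhm_card_candidates_le L x)
      _ = 25 * (2 * p ^ 2) := mul_comm _ _
  calc ‖(∑ x ∈ B, localPair g L x) * (∑ x ∈ B, localPair g L x)ᴴ -
        (∑ x ∈ B, localPair g L x)ᴴ * (∑ x ∈ B, localPair g L x)‖
      = ‖∑ x ∈ B, ∑ y ∈ B, T x y‖ := by rw [hsum]
    _ ≤ ∑ x ∈ B, ‖∑ y ∈ B, T x y‖ := norm_sum_le _ _
    _ ≤ ∑ x ∈ B, ∑ y ∈ B, ‖T x y‖ := Finset.sum_le_sum fun x _ => norm_sum_le _ _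
    _ ≤ ∑ _x ∈ B, 25 * (2 * p ^ 2) := Finset.sum_le_sum fun x _ => hx x
    _ = 25 * (2 * p ^ 2) * B.card := by rw [Finset.sum_const, nsmul_eq_mul]; ring

/-- **`‖Q [Δ_B, H] - [Δ_B, H] Q‖ ≤ 36 s²(s+2) K² (2|t|+|U|+2|μ|) |B|`** for `Q = Δ_B` and for
`Q = Δ_Bᴴ`: the two-family Koma–Tasaki count over the index type `B`.
[cite: KomaTasaki1994, Theorem 2.2] -/
theorem hcf_norm_blockPairField_doubleCommutator_le (t U μ : ℝ) [inst : DecidableEq (FermionTorus 2 L)] :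
    ‖(∑ x ∈ B, localPair g L x) *
          ((∑ x ∈ B, localPair g L x) * hubbardTorusWith 2 L t U μ -
            hubbardTorusWith 2 L t U μ * (∑ x ∈ B, localPair g L x)) -
        ((∑ x ∈ B, localPair g L x) * hubbardTorusWith 2 L t U μ -
            hubbardTorusWith 2 L t U μ * (∑ x ∈ B, localPair g L x)) * (∑ x ∈ B, localPair g L x)‖ ≤
      36 * ((insert (0 : Site 2) unitSteps).card : ℝ) ^ 2 * ((insert (0 : Site 2) unitSteps).card + 2) *
        (2 * ∑ e ∈ insert (0 : Site 2) unitSteps, |g e / Real.sqrt 2|) ^ 2 *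
        (2 * |t| + |U| + 2 * |μ|) * B.card ∧
    ‖(∑ x ∈ B, localPair g L x)ᴴ *
          ((∑ x ∈ B, localPair g L x) * hubbardTorusWith 2 L t U μ -
            hubbardTorusWith 2 L t U μ * (∑ x ∈ B, localPair g L x)) -
        ((∑ x ∈ B, localPair g L x) * hubbardTorusWith 2 L t U μ -
            hubbardTorusWith 2 L t U μ * (∑ x ∈ B, localPair g L x)) * (∑ x ∈ B, localPair g L x)ᴴ‖ ≤
      36 * ((insert (0 : Site 2) unitSteps).card : ℝ) ^ 2 * ((insert (0 : Site 2) unitSteps).card + 2) *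
        (2 * ∑ e ∈ insert (0 : Site 2) unitSteps, |g e / Real.sqrt 2|) ^ 2 *
        (2 * |t| + |U| + 2 * |μ|) * B.card := by
  have hinst : inst = LinearOrder.toDecidableEq := Subsingleton.elim _ _
  subst hinst
  letI hdec : DecidableEq (FermionTorus 2 L) := LinearOrder.toDecidableEq
  set S : Finset (Site 2) := insert 0 unitSteps with hS_def
  set K : ℝ := 2 * ∑ e ∈ S, |g e / Real.sqrt 2| with hK_def
  -- the families indexed by the subtype `B`
  set q : B → Matrix (Finset (Orb (FermionTorus 2 L))) (Finset (Orb (FermionTorus 2 L))) ℂ :=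
    fun y => localPair g L y with hq_def
  set q' : B → Matrix (Finset (Orb (FermionTorus 2 L))) (Finset (Orb (FermionTorus 2 L))) ℂ :=
    fun y => (localPair g L y)ᴴ with hq'_def
  set V : B → Finset (FermionTorus 2 L) :=
    fun y => S.image fun e => FermionTorus.ofTorusSite ((y : TorusSite 2 L) + Torus.proj L e) with hV_def
  have hyV : ∀ y : B, FermionTorus.ofTorusSite (y : TorusSite 2 L) ∈ V y := fun y => by
    have h0 : Torus.proj L (0 : Site 2) = 0 := funext fun i => by simp
    exact Finset.mem_image.2 ⟨0, Finset.mem_insert_self _ _, by rw [h0, add_zero]⟩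
  have heV : ∀ y : B, ∀ e ∈ S, FermionTorus.ofTorusSite ((y : TorusSite 2 L) + Torus.proj L e) ∈ V y :=
    fun y e he => Finset.mem_image_of_mem _ he
  have hq : ∀ y, q y ∈ carEvenSubalgebra (orbSet (V y)) := fun y => by
    simp only [hq_def]
    rw [Literature.Barriers.HubbardSuperconductivity.localPair_eq_sum_bondPair]
    exact Subalgebra.sum_mem _ fun e he =>
      Subalgebra.smul_mem _ (dc_bondPair_mem_carEvenSubalgebra (hyV y) (heV y e he)) _
  have hqc : ∀ y, q y ∈ carSubalgebra (orbSet (V y)) := fun y =>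
    carEvenSubalgebra_le_carSubalgebra _ (hq y)
  have hq' : ∀ y, q' y ∈ carSubalgebra (orbSet (V y)) := fun y => by
    refine carEvenSubalgebra_le_carSubalgebra _ ?_
    simp only [hq'_def]
    rw [Literature.Barriers.HubbardSuperconductivity.localPair_eq_sum_bondPair, conjTranspose_sum]
    refine Subalgebra.sum_mem _ fun e he => ?_
    rw [conjTranspose_smul]
    exact Subalgebra.smul_mem _ (dc_bondPair_conjTranspose_mem_carEvenSubalgebra (hyV y) (heV y e he)) _
  have hM : ∀ y, ‖q y‖ ≤ K := fun y => norm_localPair_le g L y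
  have hM' : ∀ y, ‖q' y‖ ≤ K := fun y => by
    simp only [hq'_def]
    rw [l2_opNorm_conjTranspose]
    exact norm_localPair_le g L y
  have hV : ∀ y, (V y).card ≤ S.card := fun y => Finset.card_image_le
  have hA : (∑ x ∈ B, localPair g L x) = ∑ y : B, q y := (Finset.sum_coe_sort B _).symm
  have hA' : (∑ x ∈ B, localPair g L x)ᴴ = ∑ y : B, q' y := by
    rw [conjTranspose_sum]
    exact (Finset.sum_coe_sort B _).symm
  have hN : ∀ A : Finset (FermionTorus 2 L), (Finset.univ.filter fun y : B => ¬ Disjoint A (V y)).card ≤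
      A.card * S.card := by
    intro A
    -- inject `y ↦ (y : TorusSite 2 L)` and count as in the full-torus case
    have hinj : (Finset.univ.filter fun y : B => ¬ Disjoint A (V y)).card ≤
        (A.biUnion fun w => S.image fun e => FermionTorus.toTorusSite w - Torus.proj L e).card := by
      refine Finset.card_le_card_of_injOn (fun y => (y : TorusSite 2 L)) (fun y hy => ?_)
        (fun y _ y' _ h => Subtype.ext h)
      rw [Finset.mem_coe, Finset.mem_filter] at hy
      obtain ⟨w, hwA, hwV⟩ := Finset.not_disjoint_iff.1 hy.2
      obtain ⟨e, he, hwe⟩ := Finset.mem_image.1 hwV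
      refine Finset.mem_biUnion.2 ⟨w, hwA, Finset.mem_image.2 ⟨e, he, ?_⟩⟩
      rw [← hwe, FermionTorus.toTorusSite_ofTorusSite, add_sub_cancel_right]
    refine hinj.trans ?_
    calc (A.biUnion fun w => S.image fun e => FermionTorus.toTorusSite w - Torus.proj L e).card
        ≤ ∑ w ∈ A, (S.image fun e => FermionTorus.toTorusSite w - Torus.proj L e).card :=
          Finset.card_biUnion_le
      _ ≤ ∑ _w ∈ A, S.card := Finset.sum_le_sum fun w _ => Finset.card_image_le
      _ = A.card * S.card := by rw [Finset.sum_const, smul_eq_mul]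
  have hcard : (Fintype.card B : ℝ) = B.card := by rw [Fintype.card_coe]
  constructor
  · have key := dcq_norm_doubleCommutator_le (fermionTorusGraph 2 L) (Δ := 4) (s := S.card)
      (fun x => SourceGas.card_filter_fermionTorusGraph_adj_le x) t U μ V q q hq hqc (M := K)
      (by positivity) hM hM hV hN
    rw [hA, hubbardTorusWith]
    refine key.trans (le_of_eq ?_)
    rw [hcard]
    push_cast
    ring
  · have key := dcq_norm_doubleCommutator_le (fermionTorusGraph 2 L) (Δ := 4) (s := S.card)
      (fun x => SourceGas.card_filter_fermionTorusGraph_adj_le x) t U μ V q q' hq hq' (M := K)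
      (by positivity) hM hM' hV hN
    rw [hA', hA, hubbardTorusWith]
    refine key.trans (le_of_eq ?_)
    rw [hcard]
    push_cast
    ring

/-- **Block pair densities are heavy**: for `R_B = Δ_Bᴴ Δ_B` and `H = hubbardTorusWith 2 L t U μ`,
`‖R_B [R_B, H] - [R_B, H] R_B‖ ≤ (9000 + 144 s²(s+2)) K⁴ (2|t|+|U|+2|μ|) |B|³` — the six terms
of `hcf_doubleCommutator_conjTranspose_mul_expand` with the block locality inputs.
[cite: KomaTasaki1994, Theorem 2.2] -/
theorem hcf_norm_blockPairDensity_doubleCommutator_le (t U μ : ℝ) [inst : DecidableEq (FermionTorus 2 L)] :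
    ‖((∑ x ∈ B, localPair g L x)ᴴ * (∑ x ∈ B, localPair g L x)) *
          (((∑ x ∈ B, localPair g L x)ᴴ * (∑ x ∈ B, localPair g L x)) * hubbardTorusWith 2 L t U μ -
            hubbardTorusWith 2 L t U μ * ((∑ x ∈ B, localPair g L x)ᴴ * (∑ x ∈ B, localPair g L x))) -
        (((∑ x ∈ B, localPair g L x)ᴴ * (∑ x ∈ B, localPair g L x)) * hubbardTorusWith 2 L t U μ -
            hubbardTorusWith 2 L t U μ * ((∑ x ∈ B, localPair g L x)ᴴ * (∑ x ∈ B, localPair g L x))) *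
          ((∑ x ∈ B, localPair g L x)ᴴ * (∑ x ∈ B, localPair g L x))‖ ≤
      (9000 + 144 * ((insert (0 : Site 2) unitSteps).card : ℝ) ^ 2 *
          ((insert (0 : Site 2) unitSteps).card + 2)) *
        (2 * ∑ e ∈ insert (0 : Site 2) unitSteps, |g e / Real.sqrt 2|) ^ 4 *
        (2 * |t| + |U| + 2 * |μ|) * (B.card : ℝ) ^ 3 := by
  set s : ℝ := ((insert (0 : Site 2) unitSteps).card : ℝ) with hs_def
  set K : ℝ := 2 * ∑ e ∈ insert (0 : Site 2) unitSteps, |g e / Real.sqrt 2| with hK_def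
  set J : ℝ := 2 * |t| + |U| + 2 * |μ| with hJ_def
  set n : ℝ := (B.card : ℝ) with hn_def
  set A := ∑ x ∈ B, localPair g L x with hA_def
  set Hm := hubbardTorusWith 2 L t U μ with hHm_def
  set Bm := Aᴴ with hB_def
  set D := A * Hm - Hm * A with hD_def
  set E := Hm * Bm - Bm * Hm with hE_def
  have hK0 : 0 ≤ K := by positivity
  have hJ0 : 0 ≤ J := by positivity
  have hs0 : 0 ≤ s := by positivity
  have hn0 : 0 ≤ n := by positivity
  have hHerm : Hmᴴ = Hm := (isHermitian_hubbardTorusWith L t U μ).eq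
  have hEadj : E = Dᴴ := by
    simp only [hE_def, hD_def, hB_def, conjTranspose_sub, conjTranspose_mul, hHerm]
  have hDadj : Eᴴ = D := by rw [hEadj, conjTranspose_conjTranspose]
  have hnA : ‖A‖ ≤ K * n := hcf_norm_blockPairField_le g L B
  have hnB : ‖Bm‖ ≤ K * n := by rw [hB_def, l2_opNorm_conjTranspose]; exact hnA
  have hnD : ‖D‖ ≤ 90 * J * K * n := by
    have h := hcf_norm_comm_hubbardTorusWith_blockPairField_le g L B t U μ
    rw [hD_def, ← norm_neg, neg_sub]
    refine h.trans (le_of_eq ?_)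
    simp only [hJ_def, hK_def, hn_def]
    ring
  have hnE : ‖E‖ ≤ 90 * J * K * n := by rw [hEadj, l2_opNorm_conjTranspose]; exact hnD
  have hAB : ‖A * Bm - Bm * A‖ ≤ 50 * K ^ 2 * n := by
    have h := hcf_norm_comm_blockPairField_conjTranspose_le g L B
    refine h.trans (le_of_eq ?_)
    simp only [hK_def, hn_def]
    ring
  obtain ⟨hAD0, hBD0⟩ := hcf_norm_blockPairField_doubleCommutator_le g L B t U μ
  have hAD : ‖A * D - D * A‖ ≤ 36 * s ^ 2 * (s + 2) * K ^ 2 * J * n := hAD0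
  have hBD : ‖Bm * D - D * Bm‖ ≤ 36 * s ^ 2 * (s + 2) * K ^ 2 * J * n := hBD0
  clear hAD0 hBD0
  have hAE : ‖A * E - E * A‖ ≤ 36 * s ^ 2 * (s + 2) * K ^ 2 * J * n := by
    have h1 : (A * E - E * A)ᴴ = -(Bm * D - D * Bm) := by
      simp only [conjTranspose_sub, conjTranspose_mul, hDadj, ← hB_def]
      abel
    rw [← l2_opNorm_conjTranspose, h1, norm_neg]
    exact hBD
  have hBE : ‖Bm * E - E * Bm‖ ≤ 36 * s ^ 2 * (s + 2) * K ^ 2 * J * n := by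
    have hBadj : Bmᴴ = A := by rw [hB_def, conjTranspose_conjTranspose]
    have h1 : (Bm * E - E * Bm)ᴴ = -(A * D - D * A) := by
      simp only [conjTranspose_sub, conjTranspose_mul, hDadj, hBadj]
      abel
    rw [← l2_opNorm_conjTranspose, h1, norm_neg]
    exact hAD
  rw [hcf_doubleCommutator_conjTranspose_mul_expand A Bm Hm D E hD_def hE_def]
  have hc0 : 0 ≤ 36 * s ^ 2 * (s + 2) * K ^ 2 * J * n := by positivity
  have hKn : 0 ≤ K * n := mul_nonneg hK0 hn0
  have h3 : ∀ (X Y Z : Matrix (Finset (Orb (FermionTorus 2 L))) (Finset (Orb (FermionTorus 2 L))) ℂ)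
      (a b c : ℝ), ‖X‖ ≤ a → ‖Y‖ ≤ b → ‖Z‖ ≤ c → 0 ≤ a → 0 ≤ b → ‖X * Y * Z‖ ≤ a * b * c := by
    intro X Y Z a b c hX hY hZ ha hb
    calc ‖X * Y * Z‖ ≤ ‖X‖ * ‖Y‖ * ‖Z‖ :=
          (norm_mul_le _ _).trans (mul_le_mul_of_nonneg_right (norm_mul_le _ _) (norm_nonneg _))
      _ ≤ a * b * c := mul_le_mul (mul_le_mul hX hY (norm_nonneg _) ha) hZ (norm_nonneg _)
          (mul_nonneg ha hb)
  have hT1 : ‖Bm * (A * Bm - Bm * A) * D‖ ≤ (K * n) * (50 * K ^ 2 * n) * (90 * J * K * n) :=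
    h3 _ _ _ _ _ _ hnB hAB hnD hKn (by positivity)
  have hT2 : ‖Bm * Bm * (A * D - D * A)‖ ≤ (K * n) * (K * n) * (36 * s ^ 2 * (s + 2) * K ^ 2 * J * n) :=
    h3 _ _ _ _ _ _ hnB hnB hAD hKn hKn
  have hT3 : ‖Bm * (Bm * D - D * Bm) * A‖ ≤ (K * n) * (36 * s ^ 2 * (s + 2) * K ^ 2 * J * n) * (K * n) :=
    h3 _ _ _ _ _ _ hnB hBD hnA hKn hc0
  have hT4 : ‖Bm * (A * E - E * A) * A‖ ≤ (K * n) * (36 * s ^ 2 * (s + 2) * K ^ 2 * J * n) * (K * n) :=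
    h3 _ _ _ _ _ _ hnB hAE hnA hKn hc0
  have hT5 : ‖(Bm * E - E * Bm) * A * A‖ ≤ (36 * s ^ 2 * (s + 2) * K ^ 2 * J * n) * (K * n) * (K * n) :=
    h3 _ _ _ _ _ _ hBE hnA hnA hc0 hKn
  have hT6 : ‖E * (A * Bm - Bm * A) * A‖ ≤ (90 * J * K * n) * (50 * K ^ 2 * n) * (K * n) :=
    h3 _ _ _ _ _ _ hnE hAB hnA (by positivity) (by positivity)
  calc ‖Bm * (A * Bm - Bm * A) * D + Bm * Bm * (A * D - D * A) + Bm * (Bm * D - D * Bm) * A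
          - Bm * (A * E - E * A) * A - (Bm * E - E * Bm) * A * A + E * (A * Bm - Bm * A) * A‖
      ≤ ‖Bm * (A * Bm - Bm * A) * D‖ + ‖Bm * Bm * (A * D - D * A)‖ + ‖Bm * (Bm * D - D * Bm) * A‖
          + ‖Bm * (A * E - E * A) * A‖ + ‖(Bm * E - E * Bm) * A * A‖ + ‖E * (A * Bm - Bm * A) * A‖ := by
        refine (norm_add_le _ _).trans (add_le_add ?_ le_rfl)
        refine (norm_sub_le _ _).trans (add_le_add ?_ le_rfl)
        refine (norm_sub_le _ _).trans (add_le_add ?_ le_rfl)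
        refine (norm_add_le _ _).trans (add_le_add ?_ le_rfl)
        exact norm_add_le _ _
    _ ≤ (K * n) * (50 * K ^ 2 * n) * (90 * J * K * n)
          + (K * n) * (K * n) * (36 * s ^ 2 * (s + 2) * K ^ 2 * J * n)
          + (K * n) * (36 * s ^ 2 * (s + 2) * K ^ 2 * J * n) * (K * n)
          + (K * n) * (36 * s ^ 2 * (s + 2) * K ^ 2 * J * n) * (K * n)
          + (36 * s ^ 2 * (s + 2) * K ^ 2 * J * n) * (K * n) * (K * n)
          + (90 * J * K * n) * (50 * K ^ 2 * n) * (K * n) :=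
        add_le_add (add_le_add (add_le_add (add_le_add (add_le_add hT1 hT2) hT3) hT4) hT5) hT6
    _ = (9000 + 144 * s ^ 2 * (s + 2)) * K ^ 4 * J * n ^ 3 := by ring

/-- **Block condensates are heavy with mass `∝ |B|`** (card `heavy-condensate-fibration`, item 3;
the input of the joint fibration over block amplitudes and of the companion `poincare-telescope`):
for EVERY finite set `B` of torus sites, the block condensate `Π_B = |B|⁻² Δ_Bᴴ Δ_B`
(`Δ_B = Σ_{x∈B} P_x`, `u_B = |B|⁻¹ Δ_B`) obeys
`‖Π_B [Π_B, H] - [Π_B, H] Π_B‖ ≤ (9000 + 144 s²(s+2)) K⁴ (2|t|+|U|+2|μ|) / |B|`,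
uniformly in the volume and in the shape of `B` (`|B| = ℓ²` for an `ℓ × ℓ` block: mass `∝ ℓ²`).
For `B = ∅` both sides vanish. [cite: KomaTasaki1994, Theorem 2.2] -/
theorem hcf_norm_blockCondensate_doubleCommutator_le (t U μ : ℝ) [inst : DecidableEq (FermionTorus 2 L)] :
    ‖(((1 : ℂ) / ((B.card : ℂ) ^ 2)) • ((∑ x ∈ B, localPair g L x)ᴴ * (∑ x ∈ B, localPair g L x))) *
          ((((1 : ℂ) / ((B.card : ℂ) ^ 2)) • ((∑ x ∈ B, localPair g L x)ᴴ * (∑ x ∈ B, localPair g L x))) *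
              hubbardTorusWith 2 L t U μ -
            hubbardTorusWith 2 L t U μ *
              (((1 : ℂ) / ((B.card : ℂ) ^ 2)) • ((∑ x ∈ B, localPair g L x)ᴴ * (∑ x ∈ B, localPair g L x)))) -
        ((((1 : ℂ) / ((B.card : ℂ) ^ 2)) • ((∑ x ∈ B, localPair g L x)ᴴ * (∑ x ∈ B, localPair g L x))) *
              hubbardTorusWith 2 L t U μ -
            hubbardTorusWith 2 L t U μ *
              (((1 : ℂ) / ((B.card : ℂ) ^ 2)) • ((∑ x ∈ B, localPair g L x)ᴴ * (∑ x ∈ B, localPair g L x)))) *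
          (((1 : ℂ) / ((B.card : ℂ) ^ 2)) • ((∑ x ∈ B, localPair g L x)ᴴ * (∑ x ∈ B, localPair g L x)))‖ ≤
      (9000 + 144 * ((insert (0 : Site 2) unitSteps).card : ℝ) ^ 2 *
          ((insert (0 : Site 2) unitSteps).card + 2)) *
        (2 * ∑ e ∈ insert (0 : Site 2) unitSteps, |g e / Real.sqrt 2|) ^ 4 *
        (2 * |t| + |U| + 2 * |μ|) / B.card := by
  rw [hcf_doubleCommutator_smul, norm_smul]
  have h := hcf_norm_blockPairDensity_doubleCommutator_le g L B t U μ (inst := inst)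
  by_cases hB : B.card = 0
  · -- empty block: everything vanishes
    have hB' : B = ∅ := Finset.card_eq_zero.1 hB
    subst hB'
    simp
  have hn : (0 : ℝ) < (B.card : ℝ) := Nat.cast_pos.2 (Nat.pos_of_ne_zero hB)
  have hc : ‖(1 : ℂ) / ((B.card : ℂ) ^ 2) * ((1 : ℂ) / ((B.card : ℂ) ^ 2))‖ = 1 / (B.card : ℝ) ^ 4 := by
    rw [norm_mul, norm_div, norm_one, norm_pow, Complex.norm_natCast]
    field_simp
  rw [hc]
  calc 1 / (B.card : ℝ) ^ 4 * _ ≤ 1 / (B.card : ℝ) ^ 4 *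
        ((9000 + 144 * ((insert (0 : Site 2) unitSteps).card : ℝ) ^ 2 *
          ((insert (0 : Site 2) unitSteps).card + 2)) *
          (2 * ∑ e ∈ insert (0 : Site 2) unitSteps, |g e / Real.sqrt 2|) ^ 4 *
          (2 * |t| + |U| + 2 * |μ|) * (B.card : ℝ) ^ 3) :=
        mul_le_mul_of_nonneg_left h (by positivity)
    _ = _ := by
        field_simp

end Block

end Summit.HubbardSuperconductivity.HubbardSuperconductivity.Theorems
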